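import Summits.BirchSwinnertonDyer.Rank1Residual.Supersingular.KobayashiSqueezeReal
import Literature.NumberTheory.EllipticCurves.Kobayashi2003.SignedPAdicLFunctionUniqueProofs
import Literature.NumberTheory.EllipticCurves.BurungaleSkinnerTianWan2024.SignedMainStatementSemistableOPEN
import HarnessLib

/-!
# Bridge (theorems only): the Summits-side typed inputs `KobayashiMainConjecture W p ε` /
# `BurungaleSkinnerTianWan2024_thm13_OPEN` ↔ the Literature binders of
# `BurungaleSkinnerTianWan2024/SignedMainStatement{RankOneBSD,Semistable}OPEN.lean`
# (`SignedCharIdealEqPadicLFunctionNeron W p ε`, `thm101_signedMainStatement_semistable_OPEN`)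

STAGED by the typer seat `bsd-littype-01` (gen 3; literature seats cannot file Summits-side): to be
filed UNCHANGED by a prover/planner of cell `bsd-ssimc` (K3) or `b2b-bsdres` next to
`Supersingular/KobayashiMainConjecture.lean`. Farm `lean check` rc 0 at staging time. Nothing asserted;
no `sorry`; no new definition; no named fact. The dictionary is: a Pollack pair `(L⁺, L⁻)`
(`IsPollackPair`, Pollack's labelling) gives Kobayashi's `L_p^ε = kobayashiL ε L⁺ L⁻` with
`Kobayashi2003.IsSignedPAdicLFunction f p ε (kobayashiL ε L⁺ L⁻)`; conversely, granted Pollack's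
existence fact, the unique `L` with `IsSignedPAdicLFunction f p ε L` is the `ε`-member of a Pollack pair
(`IsSignedPAdicLFunction.unique`). The labelling lemma
`IsPollackPair.isSignedPAdicLFunction_kobayashiL` is the tree's (`KobayashiSqueezeReal.lean`, p213197).
-/

noncomputable section

open scoped Classical MatrixGroups ModularForm

open CongruenceSubgroup WeierstrassCurve Literature.NumberTheory.EllipticCurves
  Literature.NumberTheory.EllipticCurves.ModularForms
  Literature.NumberTheory.EllipticCurves.Rank1Residual
  Literature.NumberTheory.EllipticCurves.Kobayashi2003
  Literature.NumberTheory.EllipticCurves.BurungaleSkinnerTianWan2024 ZpExtension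

namespace Summit.BirchSwinnertonDyer.Rank1Residual.Supersingular

/-- **Literature ⇒ Summits**: the Literature predicate `SignedCharIdealEqPadicLFunctionNeron W p ε`
(quantified over Kobayashi's `L_p^ε`) implies the Summits-side `KobayashiMainConjecture W p ε`
(quantified over Pollack pairs). Unconditional. [cite: Kobayashi2003, Main Conj. (p. 2)] -/
theorem kobayashiMainConjecture_of_signedCharIdealEq {W : WeierstrassCurve ℚ} [W.IsElliptic]
    [W.IsGloballyMinimal] {p : ℕ} [Fact p.Prime] {ε : ℤˣ}
    (h : SignedCharIdealEqPadicLFunctionNeron W p ε) : KobayashiMainConjecture W p ε := by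
  intro κ γ hκ hγ hγ' _ f hf ϖ hϖ Lplus Lminus hL D
  exact h κ γ hκ hγ hγ' f hf ϖ hϖ (kobayashiL ε Lplus Lminus)
    (hL.isSignedPAdicLFunction_kobayashiL ε) D

/-- **Summits ⇒ Literature**, granted Pollack's existence fact (`hP`, for the newform of `W` at level
`N_E`) at a good prime `p ≠ 2` with `a_p = 0`: `KobayashiMainConjecture W p ε` implies
`SignedCharIdealEqPadicLFunctionNeron W p ε` (the given `L` is the `ε`-member of a Pollack pair by
uniqueness). [cite: Kobayashi2003, Main Conj. (p. 2) and Thm. 3.2 (p. 7)] [cite: Pollack2003, Thm. 5.6 and Prop. 6.18] -/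
theorem signedCharIdealEq_of_kobayashiMainConjecture {W : WeierstrassCurve ℚ} [W.IsElliptic]
    [W.IsGloballyMinimal] [NeZero (W.conductorNorm ℤ)] {p : ℕ} [Fact p.Prime] {ε : ℤˣ}
    (hP : ∀ f : CuspForm (Gamma0 (W.conductorNorm ℤ)) 2,
      pollack_exists_plusMinusPAdicLFunction (W := W) (f := f) (p := p))
    (hp : p ≠ 2) (hgood : W.HasGoodReductionAtPrime p) (hap : W.frobeniusTrace p = 0)
    (h : KobayashiMainConjecture W p ε) : SignedCharIdealEqPadicLFunctionNeron W p ε := by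
  intro κ γ hκ hγ hγ' _ f hf ϖ hϖ L hL D
  obtain ⟨Lplus, Lminus, hpair⟩ := exists_isPollackPair (hP f) hp hf hgood hap
  have hL' : L = kobayashiL ε Lplus Lminus := hL.unique (hpair.isSignedPAdicLFunction_kobayashiL ε)
  subst hL'
  exact h κ γ hκ hγ hγ' f hf ϖ hϖ Lplus Lminus hpair D

/-- **The two typings of BSTW Thm. 1.3 / Thm. 10.1 (semistable clause) agree**, Literature ⇒ Summits:
`thm101_signedMainStatement_semistable_OPEN` (body wording, `a_p = 0`) implies
`BurungaleSkinnerTianWan2024_thm13_OPEN` (Introduction wording, `GoodSS` + (h4)). Unconditional.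
[cite: BurungaleSkinnerTianWan2024, Thm. 1.3 (p. 3) and Thm. 10.1 (p. 86) (OPEN binders; bookkeeping)] -/
theorem thm13_OPEN_of_thm101_OPEN (h : thm101_signedMainStatement_semistable_OPEN) :
    BurungaleSkinnerTianWan2024_thm13_OPEN := by
  intro W _ _ p _ hp hsst hss h4 ε
  exact kobayashiMainConjecture_of_signedCharIdealEq
    (h W p hp hsst hss.1 (frobeniusTrace_eq_zero_of_goodSS_of_h4 W p hp hss h4) ε)

/-- Summits ⇒ Literature for the semistable clause, granted Pollack's existence fact at every
semistable `(W, p)` in scope. [cite: BurungaleSkinnerTianWan2024, Thm. 1.3 (p. 3) and Thm. 10.1 (p. 86) (OPEN binders; bookkeeping)] -/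
theorem thm101_OPEN_of_thm13_OPEN
    (hP : ∀ (W : WeierstrassCurve ℚ) [W.IsElliptic] [W.IsGloballyMinimal] [NeZero (W.conductorNorm ℤ)]
      (p : ℕ) [Fact p.Prime] (f : CuspForm (Gamma0 (W.conductorNorm ℤ)) 2),
      pollack_exists_plusMinusPAdicLFunction (W := W) (f := f) (p := p))
    (h : BurungaleSkinnerTianWan2024_thm13_OPEN) : thm101_signedMainStatement_semistable_OPEN := by
  intro W _ _ p _ hp hsst hgood hap ε
  have hss : GoodSS W p := ⟨hgood, by rw [hap]; exact dvd_zero _⟩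
  have h4 : p = 3 → W.frobeniusTrace 3 = 0 := by rintro rfl; exact hap
  intro κ γ hκ hγ hγ' _ f hf ϖ hϖ L hL D
  exact signedCharIdealEq_of_kobayashiMainConjecture (hP W p) hp hgood hap (h W p hp hsst hss h4 ε)
    κ γ hκ hγ hγ' f hf ϖ hϖ L hL D

end Summit.BirchSwinnertonDyer.Rank1Residual.Supersingular

end
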